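import Summits.KontsevichZagierPeriods.KontsevichZagierPeriods.Theorems.HurwitzMicroSectorsHurwitzSectorComplementStubLadderDescentSteps
import Summits.KontsevichZagierPeriods.KontsevichZagierPeriods.Theorems.HurwitzMicroSectorsHurwitzSectorComplementStubLadderEngine

/-!
# `HurwitzSectorComplement` (stmt-KontsevichZagierPeriods-14341), line `chebyshev-level-deformation`,
# stub S3 `stub_ladderDescent` — part 4: the descent by well-founded recursion on the weight

Def-free. The registered stub `stub_ladderDescent` (S1 engine → S2a arcs → S2b bottom cell → the four
descents `[(0,1)^w, T(tan(πj/L), t)]`, `[(0,1)^w, U(tan(πj/L), t)]`, `[(0,1)^w, 1/(1−t)]`,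
`[(0,1)^w, 1/(1+t)] ∈ ℚ·𝔭_w`, `𝔭_w = [(0,1)^w, ∏ 2/(1+x_i²)]`) is closed here from the landed parts 1–3
(`…StubLadderDescentAlgebra`, `…Engine`, `…Steps`).

The ladder has three families of objects indexed by the number `d` of box coordinates (the *weight*
of the box factor):

* `𝔘_d` — the U-objects `[(0,1)^d × Δ_{k+1}(v₀), (∏ 2/(1+y_i²)) · U(y₀, p)]`, `p = x₁⋯x_d`,
  `v₀ = tan(πj/L)`, all `k, j, L`;
* `𝔗_d` — the T-objects `[(0,1)^d × Δ_{k+1}(v₀), (∏ 2/(1+y_i²)) · T(y₀, p)]`;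
* `ζ_d` — `[(0,1)^d, 1/(1 − p)]`;

each asserted to lie in `ℚ·𝔭`. The landed steps are `𝔘_1` (bottom cell, S2b), `ζ_{N+2} ⇐ 𝔘_{N+1}`
(`step_zeta`, the ladder at `v₀ = 1`), `𝔗_{N+2} ⇐ ζ_{N+2}, S2a, 𝔘_{N+1}` (`step_T`) and — proved here from
the U-step of the engine — `𝔘_{m+2} ⇐ 𝔗_{m+1}` (`U_of_T`). The statement
`Φ(d) := (d odd → 𝔘_d) ∧ (d even, d ≥ 2 → ζ_d ∧ 𝔗_d)` is then proved for every `d` by WELL-FOUNDED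
(strong) recursion on the weight `d` (`descent_weight`): every step above only calls `Φ` at strictly
smaller weights (`𝔘_{m+2}` needs `𝔗_{m+1}`; `ζ_{N+2}`, `𝔗_{N+2}` need `𝔘_{N+1}`), and parity walks
`𝔘_1 → ζ_2, 𝔗_2 → 𝔘_3 → ζ_4, 𝔗_4 → ⋯`. The four descents are read off: (C1) is `conc_T`, (C2) is one
first U-step `ladder_U0` followed by `𝔗_{w−1}`, (C3) is `ζ_w`, (C4) is `conc_inv`.

With the landed engine S1 (`stub_ladderEngine`) plugged in, the registered sub-goal
`ladderDescent_ofArcsBottom` records S3 conditional only on S2a and on the bottom cell S2b.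

References: M. Kontsevich, D. Zagier, *Periods* (2001), §1.2.
-/

noncomputable section

open Set MeasureTheory
open scoped BigOperators
open Literature.NumberTheory.Transcendental

namespace Summit.KontsevichZagierPeriods.Theorems.HurwitzMicroSectorsHurwitzSectorComplement

namespace LadderDescent

section Engine

variable (hT :
    (∀ (m k : ℕ) (D : Set (Fin k → ℝ)) (W lam : (Fin k → ℝ) → ℝ) (M Λ : ℝ),
      Literature.ModelTheory.ExponentialFields.IsSemialgebraic ℚ D → Bornology.IsBounded D →
      IsSemialgebraicFunOn ℚ D W → IsSemialgebraicFunOn ℚ D lam →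
      (∀ y ∈ D, |W y| ≤ M) → (∀ y ∈ D, 0 < lam y ∧ lam y ≤ Λ) →
      ∀ (r : KZ.IntegralRep (m + 2 + k)),
        r.domain = {z | (∀ i : Fin (m + 2), z (Fin.castAdd k i) ∈ Set.Ioo (0:ℝ) 1) ∧
          (fun j : Fin k => z (Fin.natAdd (m + 2) j)) ∈ D} →
        Set.EqOn r.integrand (fun z => W (fun j : Fin k => z (Fin.natAdd (m + 2) j)) *
          (((1 - ∏ i : Fin (m + 2), z (Fin.castAdd k i)) -
              (lam (fun j : Fin k => z (Fin.natAdd (m + 2) j))) ^ 2 *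
                (1 + ∏ i : Fin (m + 2), z (Fin.castAdd k i))) /
            ((1 - ∏ i : Fin (m + 2), z (Fin.castAdd k i)) ^ 2 +
              (lam (fun j : Fin k => z (Fin.natAdd (m + 2) j))) ^ 2 *
                (1 + ∏ i : Fin (m + 2), z (Fin.castAdd k i)) ^ 2))) r.domain →
        ∃ (r₁ : KZ.IntegralRep (m + 2 + k)) (r₂ : KZ.IntegralRep (m + 1 + (k + 1))),
          r₁.domain = r.domain ∧
          (r₁.integrand = fun z => W (fun j : Fin k => z (Fin.natAdd (m + 2) j)) /
            (1 - ∏ i : Fin (m + 2), z (Fin.castAdd k i))) ∧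
          r₂.domain = {z | (∀ i : Fin (m + 1), z (Fin.castAdd (k + 1) i) ∈ Set.Ioo (0:ℝ) 1) ∧
            (fun j : Fin k => z (Fin.natAdd (m + 1) j.succ)) ∈ D ∧
            0 < z (Fin.natAdd (m + 1) 0) ∧
            z (Fin.natAdd (m + 1) 0) < lam ((fun j : Fin k => z (Fin.natAdd (m + 1) j.succ)))} ∧
          (r₂.integrand = fun z => W ((fun j : Fin k => z (Fin.natAdd (m + 1) j.succ))) *
            (2 / (1 + (z (Fin.natAdd (m + 1) 0)) ^ 2)) *
            (2 * z (Fin.natAdd (m + 1) 0) /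
              ((1 - ∏ i : Fin (m + 1), z (Fin.castAdd (k + 1) i)) ^ 2 +
                (z (Fin.natAdd (m + 1) 0)) ^ 2 * (1 + ∏ i : Fin (m + 1), z (Fin.castAdd (k + 1) i)) ^ 2))) ∧
          KZ.of r - KZ.of r₁ + KZ.of r₂ ∈ KZ.relations))

variable (hU :
    (∀ (m k : ℕ) (D : Set (Fin k → ℝ)) (W lam : (Fin k → ℝ) → ℝ) (M Λ : ℝ),
      Literature.ModelTheory.ExponentialFields.IsSemialgebraic ℚ D → Bornology.IsBounded D →
      IsSemialgebraicFunOn ℚ D W → IsSemialgebraicFunOn ℚ D lam →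
      (∀ y ∈ D, |W y| ≤ M) → (∀ y ∈ D, 0 < lam y ∧ lam y ≤ Λ) →
      ∀ (r : KZ.IntegralRep (m + 2 + k)),
        r.domain = {z | (∀ i : Fin (m + 2), z (Fin.castAdd k i) ∈ Set.Ioo (0:ℝ) 1) ∧
          (fun j : Fin k => z (Fin.natAdd (m + 2) j)) ∈ D} →
        Set.EqOn r.integrand (fun z => W (fun j : Fin k => z (Fin.natAdd (m + 2) j)) *
          (2 * lam (fun j : Fin k => z (Fin.natAdd (m + 2) j)) /
            ((1 - ∏ i : Fin (m + 2), z (Fin.castAdd k i)) ^ 2 +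
              (lam (fun j : Fin k => z (Fin.natAdd (m + 2) j))) ^ 2 *
                (1 + ∏ i : Fin (m + 2), z (Fin.castAdd k i)) ^ 2))) r.domain →
        ∃ (r₂ : KZ.IntegralRep (m + 1 + (k + 1))),
          r₂.domain = {z | (∀ i : Fin (m + 1), z (Fin.castAdd (k + 1) i) ∈ Set.Ioo (0:ℝ) 1) ∧
            (fun j : Fin k => z (Fin.natAdd (m + 1) j.succ)) ∈ D ∧
            0 < z (Fin.natAdd (m + 1) 0) ∧
            z (Fin.natAdd (m + 1) 0) < lam ((fun j : Fin k => z (Fin.natAdd (m + 1) j.succ)))} ∧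
          (r₂.integrand = fun z => W ((fun j : Fin k => z (Fin.natAdd (m + 1) j.succ))) *
            (2 / (1 + (z (Fin.natAdd (m + 1) 0)) ^ 2)) *
            (((1 - ∏ i : Fin (m + 1), z (Fin.castAdd (k + 1) i)) -
                (z (Fin.natAdd (m + 1) 0)) ^ 2 * (1 + ∏ i : Fin (m + 1), z (Fin.castAdd (k + 1) i))) /
              ((1 - ∏ i : Fin (m + 1), z (Fin.castAdd (k + 1) i)) ^ 2 +
                (z (Fin.natAdd (m + 1) 0)) ^ 2 * (1 + ∏ i : Fin (m + 1), z (Fin.castAdd (k + 1) i)) ^ 2))) ∧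
          KZ.of r - KZ.of r₂ ∈ KZ.relations))

variable (hA1 :
    (∀ (a j₀ j₁ L : ℕ), j₀ < j₁ → 2 * j₁ < L → ∀ (r : KZ.IntegralRep a),
      r.domain = {y | (∀ i, Real.tan (Real.pi * j₀ / L) < y i ∧ y i < Real.tan (Real.pi * j₁ / L)) ∧
        (∀ i i' : Fin a, i < i' → y i < y i')} →
      Set.EqOn r.integrand (fun y => ∏ i, 2 / (1 + (y i) ^ 2)) r.domain →
      ∃ q : ℚ, ∀ (s : KZ.IntegralRep a), s.domain = {x | ∀ i, x i ∈ Set.Ioo (0:ℝ) 1} →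
        Set.EqOn s.integrand (fun x => (q : ℝ) * ∏ i, 2 / (1 + (x i) ^ 2)) s.domain →
        KZ.Equivalent r s))

variable (hB :
    ∀ (k j L : ℕ), 0 < j → 2 * j < L → ∀ (r : KZ.IntegralRep (1 + (k + 1))),
      r.domain = {z | (∀ i : Fin (1), z (Fin.castAdd (k + 1) i) ∈ Set.Ioo (0:ℝ) 1) ∧
        (∀ i : Fin (k + 1), 0 < z (Fin.natAdd (1) i) ∧ z (Fin.natAdd (1) i) < Real.tan (Real.pi * j / L)) ∧
        (∀ i i' : Fin (k + 1), i < i' → z (Fin.natAdd (1) i) < z (Fin.natAdd (1) i'))} →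
      Set.EqOn r.integrand (fun z => (∏ i : Fin (k + 1), 2 / (1 + (z (Fin.natAdd (1) i)) ^ 2)) *
        (2 * z (Fin.natAdd (1) 0) /
          ((1 - ∏ i : Fin (1), z (Fin.castAdd (k + 1) i)) ^ 2 + (z (Fin.natAdd (1) 0)) ^ 2 * (1 + ∏ i : Fin (1), z (Fin.castAdd (k + 1) i)) ^ 2))) r.domain →
      ∃ q : ℚ, ∀ (s : KZ.IntegralRep (1 + (k + 1))), s.domain = {x | ∀ i, x i ∈ Set.Ioo (0:ℝ) 1} →
        Set.EqOn s.integrand (fun x => (q : ℝ) * ∏ i, 2 / (1 + (x i) ^ 2)) s.domain →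
        KZ.Equivalent r s)

include hU in
/-- **The U-objects from the T-objects one weight below**: `𝔘_{m+2} ⇐ 𝔗_{m+1}`. One U-step of the
engine S1 on the chain cells (`ladder_U`): `[(0,1)^{m+2} × Δ_{k+1}, W·U(y₀,p)] ≡
[(0,1)^{m+1} × Δ_{k+2}, W·ω(y)·T(y,p′)]`, and the right-hand side is a T-object of weight `m + 1`.
[cite: KontsevichZagier2001, §1.2] -/
theorem U_of_T (m : ℕ)
    (hTT : ∀ (k j L : ℕ), 0 < j → 2 * j < L → ∀ (r : KZ.IntegralRep (m + 1 + (k + 1))),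
      r.domain = {z | (∀ i : Fin (m + 1), z (Fin.castAdd (k + 1) i) ∈ Set.Ioo (0:ℝ) 1) ∧
        (∀ i : Fin (k + 1), 0 < z (Fin.natAdd (m + 1) i) ∧ z (Fin.natAdd (m + 1) i) < Real.tan (Real.pi * j / L)) ∧
        (∀ i i' : Fin (k + 1), i < i' → z (Fin.natAdd (m + 1) i) < z (Fin.natAdd (m + 1) i'))} →
      Set.EqOn r.integrand (fun z => (∏ i : Fin (k + 1), 2 / (1 + (z (Fin.natAdd (m + 1) i)) ^ 2)) *
        (((1 - ∏ i : Fin (m + 1), z (Fin.castAdd (k + 1) i)) - (z (Fin.natAdd (m + 1) 0)) ^ 2 * (1 + ∏ i : Fin (m + 1), z (Fin.castAdd (k + 1) i))) /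
          ((1 - ∏ i : Fin (m + 1), z (Fin.castAdd (k + 1) i)) ^ 2 + (z (Fin.natAdd (m + 1) 0)) ^ 2 * (1 + ∏ i : Fin (m + 1), z (Fin.castAdd (k + 1) i)) ^ 2))) r.domain →
      ∃ q : ℚ, ∀ (s : KZ.IntegralRep (m + 1 + (k + 1))), s.domain = {x | ∀ i, x i ∈ Set.Ioo (0:ℝ) 1} →
        Set.EqOn s.integrand (fun x => (q : ℝ) * ∏ i, 2 / (1 + (x i) ^ 2)) s.domain →
        KZ.Equivalent r s) :
    ∀ (k j L : ℕ), 0 < j → 2 * j < L → ∀ (r : KZ.IntegralRep (m + 2 + (k + 1))),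
      r.domain = {z | (∀ i : Fin (m + 2), z (Fin.castAdd (k + 1) i) ∈ Set.Ioo (0:ℝ) 1) ∧
        (∀ i : Fin (k + 1), 0 < z (Fin.natAdd (m + 2) i) ∧ z (Fin.natAdd (m + 2) i) < Real.tan (Real.pi * j / L)) ∧
        (∀ i i' : Fin (k + 1), i < i' → z (Fin.natAdd (m + 2) i) < z (Fin.natAdd (m + 2) i'))} →
      Set.EqOn r.integrand (fun z => (∏ i : Fin (k + 1), 2 / (1 + (z (Fin.natAdd (m + 2) i)) ^ 2)) *
        (2 * z (Fin.natAdd (m + 2) 0) /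
          ((1 - ∏ i : Fin (m + 2), z (Fin.castAdd (k + 1) i)) ^ 2 + (z (Fin.natAdd (m + 2) 0)) ^ 2 * (1 + ∏ i : Fin (m + 2), z (Fin.castAdd (k + 1) i)) ^ 2))) r.domain →
      ∃ q : ℚ, ∀ (s : KZ.IntegralRep (m + 2 + (k + 1))), s.domain = {x | ∀ i, x i ∈ Set.Ioo (0:ℝ) 1} →
        Set.EqOn s.integrand (fun x => (q : ℝ) * ∏ i, 2 / (1 + (x i) ^ 2)) s.domain →
        KZ.Equivalent r s := by
  intro k j L hj hjL r hdom hint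
  obtain ⟨r₂, h2d, h2i, hrel⟩ := ladder_U hU m k j L hj hjL r hdom hint
  have hrel' : KZ.Equivalent r r₂ := hrel
  exact inQP_cast (by omega) (inQP_of_equivalent hrel' (hTT (k + 1) j L hj hjL r₂ h2d h2i))

include hT hU hA1 hB in
/-- **The descent, by well-founded recursion on the weight.** For every number `d` of box coordinates:
if `d` is odd, every U-object `[(0,1)^d × Δ_{k+1}(tan(πj/L)), (∏ 2/(1+y_i²))·U(y₀,p)]` lies in `ℚ·𝔭`;
if `d ≥ 2` is even, `[(0,1)^d, 1/(1−p)]` and every T-object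
`[(0,1)^d × Δ_{k+1}(tan(πj/L)), (∏ 2/(1+y_i²))·T(y₀,p)]` lie in `ℚ·𝔭`. Strong induction on `d`:
`𝔘_1` is the bottom cell (S2b), `𝔘_{m+2} ⇐ 𝔗_{m+1}` (`U_of_T`), `ζ_{N+2} ⇐ 𝔘_{N+1}` (`step_zeta`, the
ladder at `tan(π/4) = 1`), `𝔗_{N+2} ⇐ ζ_{N+2}, S2a, 𝔘_{N+1}` (`step_T`) — each call is at a strictly
smaller weight. [cite: KontsevichZagier2001, §1.2] -/
theorem descent_weight (d : ℕ) :
    (Odd d → ∀ (k j L : ℕ), 0 < j → 2 * j < L → ∀ (r : KZ.IntegralRep (d + (k + 1))),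
      r.domain = {z | (∀ i : Fin d, z (Fin.castAdd (k + 1) i) ∈ Set.Ioo (0:ℝ) 1) ∧
        (∀ i : Fin (k + 1), 0 < z (Fin.natAdd d i) ∧ z (Fin.natAdd d i) < Real.tan (Real.pi * j / L)) ∧
        (∀ i i' : Fin (k + 1), i < i' → z (Fin.natAdd d i) < z (Fin.natAdd d i'))} →
      Set.EqOn r.integrand (fun z => (∏ i : Fin (k + 1), 2 / (1 + (z (Fin.natAdd d i)) ^ 2)) *
        (2 * z (Fin.natAdd d 0) /
          ((1 - ∏ i : Fin d, z (Fin.castAdd (k + 1) i)) ^ 2 + (z (Fin.natAdd d 0)) ^ 2 * (1 + ∏ i : Fin d, z (Fin.castAdd (k + 1) i)) ^ 2))) r.domain →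
      ∃ q : ℚ, ∀ (s : KZ.IntegralRep (d + (k + 1))), s.domain = {x | ∀ i, x i ∈ Set.Ioo (0:ℝ) 1} →
        Set.EqOn s.integrand (fun x => (q : ℝ) * ∏ i, 2 / (1 + (x i) ^ 2)) s.domain →
        KZ.Equivalent r s) ∧
    (Even d → 2 ≤ d →
      (∀ (r : KZ.IntegralRep d), r.domain = {x | ∀ i, x i ∈ Set.Ioo (0:ℝ) 1} →
        Set.EqOn r.integrand (fun x => 1 / (1 - ∏ i, x i)) r.domain →
        ∃ q : ℚ, ∀ (s : KZ.IntegralRep d), s.domain = {x | ∀ i, x i ∈ Set.Ioo (0:ℝ) 1} →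
          Set.EqOn s.integrand (fun x => (q : ℝ) * ∏ i, 2 / (1 + (x i) ^ 2)) s.domain →
          KZ.Equivalent r s) ∧
      (∀ (k j L : ℕ), 0 < j → 2 * j < L → ∀ (r : KZ.IntegralRep (d + (k + 1))),
        r.domain = {z | (∀ i : Fin d, z (Fin.castAdd (k + 1) i) ∈ Set.Ioo (0:ℝ) 1) ∧
          (∀ i : Fin (k + 1), 0 < z (Fin.natAdd d i) ∧ z (Fin.natAdd d i) < Real.tan (Real.pi * j / L)) ∧
          (∀ i i' : Fin (k + 1), i < i' → z (Fin.natAdd d i) < z (Fin.natAdd d i'))} →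
        Set.EqOn r.integrand (fun z => (∏ i : Fin (k + 1), 2 / (1 + (z (Fin.natAdd d i)) ^ 2)) *
          (((1 - ∏ i : Fin d, z (Fin.castAdd (k + 1) i)) - (z (Fin.natAdd d 0)) ^ 2 * (1 + ∏ i : Fin d, z (Fin.castAdd (k + 1) i))) /
            ((1 - ∏ i : Fin d, z (Fin.castAdd (k + 1) i)) ^ 2 + (z (Fin.natAdd d 0)) ^ 2 * (1 + ∏ i : Fin d, z (Fin.castAdd (k + 1) i)) ^ 2))) r.domain →
        ∃ q : ℚ, ∀ (s : KZ.IntegralRep (d + (k + 1))), s.domain = {x | ∀ i, x i ∈ Set.Ioo (0:ℝ) 1} →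
          Set.EqOn s.integrand (fun x => (q : ℝ) * ∏ i, 2 / (1 + (x i) ^ 2)) s.domain →
          KZ.Equivalent r s)) := by
  refine Nat.strong_induction_on d fun d ih => ?_
  refine ⟨fun hodd => ?_, fun heven h2 => ?_⟩
  · -- odd weight: `d = 1` (bottom cell) or `d = m + 2` with `m + 1` even, `2 ≤ m + 1 < d`
    rw [Nat.odd_iff] at hodd
    obtain rfl | ⟨m, rfl⟩ : d = 1 ∨ ∃ m, d = m + 2 := by
      rcases Nat.lt_or_ge d 2 with h | h
      · exact Or.inl (by omega)
      · exact Or.inr ⟨d - 2, by omega⟩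
    · exact hB
    · have hev : Even (m + 1) := by
        rw [Nat.even_iff]
        omega
      exact U_of_T hU m (((ih (m + 1) (by omega)).2 hev (by omega)).2)
  · -- even weight `d = N + 2`: `ζ_{N+2}` and `𝔗_{N+2}` from `𝔘_{N+1}`
    obtain ⟨N, rfl⟩ : ∃ N, d = N + 2 := ⟨d - 2, by omega⟩
    have hodd : Odd (N + 1) := by
      rw [Nat.even_iff] at heven
      rw [Nat.odd_iff]
      omega
    have hU1 := (ih (N + 1) (by omega)).1 hodd
    have hζ := step_zeta hT N hU1
    exact ⟨hζ, step_T hT hA1 N hζ hU1⟩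

end Engine

end LadderDescent

open LadderDescent in
/-- **S3, ladder descent** (registered stub of line `chebyshev-level-deformation`, crux
`HurwitzSectorComplement`). From S1 (the ladder engine), S2a (chains over cyclotomic arcs) and S2b
(the bottom cell): for cyclotomic half-angles `v₀ = tan(πj/L)` (`0 < j`, `2j < L`) the Chebyshev box
representations `[(0,1)^w, T(v₀, x₁⋯x_w)]` (`w ≥ 2` even) and `[(0,1)^w, U(v₀, x₁⋯x_w)]` (`w ≥ 3` odd),
and the level-1/2 representations `[(0,1)^w, 1/(1−t)]`, `[(0,1)^w, 1/(1+t)]` (`w ≥ 2` even), are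
KZ-equivalent to RATIONAL multiples of `𝔭_w = [(0,1)^w, ∏ 2/(1+x_i²)]`. Proof: the weight recursion
`descent_weight`; (C1) is the first T-step (`conc_T`), (C2) the first U-step (`ladder_U0`) followed by
`𝔗_{w−1}`, (C3) is `ζ_w`, (C4) is the level-4 dilation algebra (`conc_inv`).
[cite: KontsevichZagier2001, §1.2] -/
theorem stub_ladderDescent :
    ((∀ (m k : ℕ) (D : Set (Fin k → ℝ)) (W lam : (Fin k → ℝ) → ℝ) (M Λ : ℝ),
      Literature.ModelTheory.ExponentialFields.IsSemialgebraic ℚ D → Bornology.IsBounded D →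
      IsSemialgebraicFunOn ℚ D W → IsSemialgebraicFunOn ℚ D lam →
      (∀ y ∈ D, |W y| ≤ M) → (∀ y ∈ D, 0 < lam y ∧ lam y ≤ Λ) →
      ∀ (r : KZ.IntegralRep (m + 2 + k)),
        r.domain = {z | (∀ i : Fin (m + 2), z (Fin.castAdd k i) ∈ Set.Ioo (0:ℝ) 1) ∧
          (fun j : Fin k => z (Fin.natAdd (m + 2) j)) ∈ D} →
        Set.EqOn r.integrand (fun z => W (fun j : Fin k => z (Fin.natAdd (m + 2) j)) *
          (((1 - ∏ i : Fin (m + 2), z (Fin.castAdd k i)) -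
              (lam (fun j : Fin k => z (Fin.natAdd (m + 2) j))) ^ 2 *
                (1 + ∏ i : Fin (m + 2), z (Fin.castAdd k i))) /
            ((1 - ∏ i : Fin (m + 2), z (Fin.castAdd k i)) ^ 2 +
              (lam (fun j : Fin k => z (Fin.natAdd (m + 2) j))) ^ 2 *
                (1 + ∏ i : Fin (m + 2), z (Fin.castAdd k i)) ^ 2))) r.domain →
        ∃ (r₁ : KZ.IntegralRep (m + 2 + k)) (r₂ : KZ.IntegralRep (m + 1 + (k + 1))),
          r₁.domain = r.domain ∧
          (r₁.integrand = fun z => W (fun j : Fin k => z (Fin.natAdd (m + 2) j)) /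
            (1 - ∏ i : Fin (m + 2), z (Fin.castAdd k i))) ∧
          r₂.domain = {z | (∀ i : Fin (m + 1), z (Fin.castAdd (k + 1) i) ∈ Set.Ioo (0:ℝ) 1) ∧
            (fun j : Fin k => z (Fin.natAdd (m + 1) j.succ)) ∈ D ∧
            0 < z (Fin.natAdd (m + 1) 0) ∧
            z (Fin.natAdd (m + 1) 0) < lam ((fun j : Fin k => z (Fin.natAdd (m + 1) j.succ)))} ∧
          (r₂.integrand = fun z => W ((fun j : Fin k => z (Fin.natAdd (m + 1) j.succ))) *
            (2 / (1 + (z (Fin.natAdd (m + 1) 0)) ^ 2)) *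
            (2 * z (Fin.natAdd (m + 1) 0) /
              ((1 - ∏ i : Fin (m + 1), z (Fin.castAdd (k + 1) i)) ^ 2 +
                (z (Fin.natAdd (m + 1) 0)) ^ 2 * (1 + ∏ i : Fin (m + 1), z (Fin.castAdd (k + 1) i)) ^ 2))) ∧
          KZ.of r - KZ.of r₁ + KZ.of r₂ ∈ KZ.relations) ∧
    (∀ (m k : ℕ) (D : Set (Fin k → ℝ)) (W lam : (Fin k → ℝ) → ℝ) (M Λ : ℝ),
      Literature.ModelTheory.ExponentialFields.IsSemialgebraic ℚ D → Bornology.IsBounded D →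
      IsSemialgebraicFunOn ℚ D W → IsSemialgebraicFunOn ℚ D lam →
      (∀ y ∈ D, |W y| ≤ M) → (∀ y ∈ D, 0 < lam y ∧ lam y ≤ Λ) →
      ∀ (r : KZ.IntegralRep (m + 2 + k)),
        r.domain = {z | (∀ i : Fin (m + 2), z (Fin.castAdd k i) ∈ Set.Ioo (0:ℝ) 1) ∧
          (fun j : Fin k => z (Fin.natAdd (m + 2) j)) ∈ D} →
        Set.EqOn r.integrand (fun z => W (fun j : Fin k => z (Fin.natAdd (m + 2) j)) *
          (2 * lam (fun j : Fin k => z (Fin.natAdd (m + 2) j)) /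
            ((1 - ∏ i : Fin (m + 2), z (Fin.castAdd k i)) ^ 2 +
              (lam (fun j : Fin k => z (Fin.natAdd (m + 2) j))) ^ 2 *
                (1 + ∏ i : Fin (m + 2), z (Fin.castAdd k i)) ^ 2))) r.domain →
        ∃ (r₂ : KZ.IntegralRep (m + 1 + (k + 1))),
          r₂.domain = {z | (∀ i : Fin (m + 1), z (Fin.castAdd (k + 1) i) ∈ Set.Ioo (0:ℝ) 1) ∧
            (fun j : Fin k => z (Fin.natAdd (m + 1) j.succ)) ∈ D ∧
            0 < z (Fin.natAdd (m + 1) 0) ∧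
            z (Fin.natAdd (m + 1) 0) < lam ((fun j : Fin k => z (Fin.natAdd (m + 1) j.succ)))} ∧
          (r₂.integrand = fun z => W ((fun j : Fin k => z (Fin.natAdd (m + 1) j.succ))) *
            (2 / (1 + (z (Fin.natAdd (m + 1) 0)) ^ 2)) *
            (((1 - ∏ i : Fin (m + 1), z (Fin.castAdd (k + 1) i)) -
                (z (Fin.natAdd (m + 1) 0)) ^ 2 * (1 + ∏ i : Fin (m + 1), z (Fin.castAdd (k + 1) i))) /
              ((1 - ∏ i : Fin (m + 1), z (Fin.castAdd (k + 1) i)) ^ 2 +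
                (z (Fin.natAdd (m + 1) 0)) ^ 2 * (1 + ∏ i : Fin (m + 1), z (Fin.castAdd (k + 1) i)) ^ 2))) ∧
          KZ.of r - KZ.of r₂ ∈ KZ.relations)) →
    ((∀ (a j₀ j₁ L : ℕ), j₀ < j₁ → 2 * j₁ < L → ∀ (r : KZ.IntegralRep a),
      r.domain = {y | (∀ i, Real.tan (Real.pi * j₀ / L) < y i ∧ y i < Real.tan (Real.pi * j₁ / L)) ∧
        (∀ i i' : Fin a, i < i' → y i < y i')} →
      Set.EqOn r.integrand (fun y => ∏ i, 2 / (1 + (y i) ^ 2)) r.domain →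
      ∃ q : ℚ, ∀ (s : KZ.IntegralRep a), s.domain = {x | ∀ i, x i ∈ Set.Ioo (0:ℝ) 1} →
        Set.EqOn s.integrand (fun x => (q : ℝ) * ∏ i, 2 / (1 + (x i) ^ 2)) s.domain →
        KZ.Equivalent r s) ∧
    (∀ (r : KZ.IntegralRep 1), r.domain = {z | 0 < z 0} →
      Set.EqOn r.integrand (fun z => 1 / (1 + (z 0) ^ 2)) r.domain →
      ∀ (s : KZ.IntegralRep 1), s.domain = {x | ∀ i, x i ∈ Set.Ioo (0:ℝ) 1} →
        Set.EqOn s.integrand (fun x => ∏ i, 2 / (1 + (x i) ^ 2)) s.domain →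
        KZ.Equivalent r s)) →
    (∀ (k j L : ℕ), 0 < j → 2 * j < L → ∀ (r : KZ.IntegralRep (1 + (k + 1))),
      r.domain = {z | z (Fin.castAdd (k + 1) 0) ∈ Set.Ioo (0:ℝ) 1 ∧
        (∀ i : Fin (k + 1), 0 < z (Fin.natAdd 1 i) ∧ z (Fin.natAdd 1 i) < Real.tan (Real.pi * j / L)) ∧
        (∀ i i' : Fin (k + 1), i < i' → z (Fin.natAdd 1 i) < z (Fin.natAdd 1 i'))} →
      Set.EqOn r.integrand (fun z => (∏ i : Fin (k + 1), 2 / (1 + (z (Fin.natAdd 1 i)) ^ 2)) *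
        (2 * z (Fin.natAdd 1 0) /
          ((1 - z (Fin.castAdd (k + 1) 0)) ^ 2 +
            (z (Fin.natAdd 1 0)) ^ 2 * (1 + z (Fin.castAdd (k + 1) 0)) ^ 2))) r.domain →
      ∃ q : ℚ, ∀ (s : KZ.IntegralRep (1 + (k + 1))), s.domain = {x | ∀ i, x i ∈ Set.Ioo (0:ℝ) 1} →
        Set.EqOn s.integrand (fun x => (q : ℝ) * ∏ i, 2 / (1 + (x i) ^ 2)) s.domain →
        KZ.Equivalent r s) →
    (∀ (w j L : ℕ), 2 ≤ w → Even w → 0 < j → 2 * j < L → ∀ (r : KZ.IntegralRep w),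
      r.domain = {x | ∀ i, x i ∈ Set.Ioo (0:ℝ) 1} →
      Set.EqOn r.integrand (fun x =>
        ((1 - ∏ i, x i) - (Real.tan (Real.pi * j / L)) ^ 2 * (1 + ∏ i, x i)) /
          ((1 - ∏ i, x i) ^ 2 + (Real.tan (Real.pi * j / L)) ^ 2 * (1 + ∏ i, x i) ^ 2)) r.domain →
      ∃ q : ℚ, ∀ (s : KZ.IntegralRep w), s.domain = {x | ∀ i, x i ∈ Set.Ioo (0:ℝ) 1} →
        Set.EqOn s.integrand (fun x => (q : ℝ) * ∏ i, 2 / (1 + (x i) ^ 2)) s.domain →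
        KZ.Equivalent r s) ∧
    (∀ (w j L : ℕ), 3 ≤ w → Odd w → 0 < j → 2 * j < L → ∀ (r : KZ.IntegralRep w),
      r.domain = {x | ∀ i, x i ∈ Set.Ioo (0:ℝ) 1} →
      Set.EqOn r.integrand (fun x =>
        2 * Real.tan (Real.pi * j / L) /
          ((1 - ∏ i, x i) ^ 2 + (Real.tan (Real.pi * j / L)) ^ 2 * (1 + ∏ i, x i) ^ 2)) r.domain →
      ∃ q : ℚ, ∀ (s : KZ.IntegralRep w), s.domain = {x | ∀ i, x i ∈ Set.Ioo (0:ℝ) 1} →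
        Set.EqOn s.integrand (fun x => (q : ℝ) * ∏ i, 2 / (1 + (x i) ^ 2)) s.domain →
        KZ.Equivalent r s) ∧
    (∀ (w : ℕ), 2 ≤ w → Even w → ∀ (r : KZ.IntegralRep w),
      r.domain = {x | ∀ i, x i ∈ Set.Ioo (0:ℝ) 1} →
      Set.EqOn r.integrand (fun x => 1 / (1 - ∏ i, x i)) r.domain →
      ∃ q : ℚ, ∀ (s : KZ.IntegralRep w), s.domain = {x | ∀ i, x i ∈ Set.Ioo (0:ℝ) 1} →
        Set.EqOn s.integrand (fun x => (q : ℝ) * ∏ i, 2 / (1 + (x i) ^ 2)) s.domain →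
        KZ.Equivalent r s) ∧
    (∀ (w : ℕ), 2 ≤ w → Even w → ∀ (r : KZ.IntegralRep w),
      r.domain = {x | ∀ i, x i ∈ Set.Ioo (0:ℝ) 1} →
      Set.EqOn r.integrand (fun x => 1 / (1 + ∏ i, x i)) r.domain →
      ∃ q : ℚ, ∀ (s : KZ.IntegralRep w), s.domain = {x | ∀ i, x i ∈ Set.Ioo (0:ℝ) 1} →
        Set.EqOn s.integrand (fun x => (q : ℝ) * ∏ i, 2 / (1 + (x i) ^ 2)) s.domain →
        KZ.Equivalent r s) := by
  rintro ⟨hT, hU⟩ ⟨hA1, -⟩ hBot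
  have hB := base_of_bottomCell hBot
  have hΦ := fun d => descent_weight hT hU hA1 hB d
  -- `ζ_{N+2}`, `𝔗_{N+2}` and `𝔘_{N+1}` for every `N` with `N + 2` even
  have hE : ∀ N : ℕ, Even (N + 2) → Odd (N + 1) := fun N h => by
    rw [Nat.even_iff] at h
    rw [Nat.odd_iff]
    omega
  refine ⟨?_, ?_, ?_, ?_⟩
  · -- (C1): the first T-step `[T(v₀,p)] ≡ [1/(1−p)] − 𝔘_{N+1,1}` (`conc_T`)
    intro w j L hw hev hj hjL r hdom hint
    obtain ⟨N, rfl⟩ : ∃ N, w = N + 2 := ⟨w - 2, by omega⟩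
    exact conc_T hT N ((hΦ (N + 2)).2 hev hw).1 ((hΦ (N + 1)).1 (hE N hev)) j L hj hjL r hdom hint
  · -- (C2): the first U-step `[U(v₀,p)] ≡ [(0,1)^{m+1} × Δ₁, ω T]`, then `𝔗_{m+1}` (`m + 1` even)
    intro w j L hw hodd hj hjL r hdom hint
    obtain ⟨m, rfl⟩ : ∃ m, w = m + 2 := ⟨w - 2, by omega⟩
    have hev : Even (m + 1) := by
      rw [Nat.odd_iff] at hodd
      rw [Nat.even_iff]
      omega
    obtain ⟨r₂, h2d, h2i, hrel⟩ := ladder_U0 hU m j L hj hjL r hdom hint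
    have hrel' : KZ.Equivalent r r₂ := hrel
    exact inQP_cast (by omega) (inQP_of_equivalent hrel'
      (((hΦ (m + 1)).2 hev (by omega)).2 0 j L hj hjL r₂ h2d h2i))
  · -- (C3): `ζ_w`
    intro w hw hev r hdom hint
    exact ((hΦ w).2 hev hw).1 r hdom hint
  · -- (C4): `[1/(1+t)] ⇐ [1/(1−t)]` by the level-4 dilation algebra
    intro w hw hev
    exact conc_inv w hw ((hΦ w).2 hev hw).1


/-! ## Registered sub-goal -/

/-- **Registered sub-goal `ladderDescent_ofArcsBottom`** (line `chebyshev-level-deformation`, stub S3):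
the four descents of `stub_ladderDescent` with the landed ladder engine S1 (`stub_ladderEngine`)
plugged in — conditional only on S2a (chains over cyclotomic arcs) and on the conclusion of S2b (the
bottom cell). [cite: KontsevichZagier2001, §1.2] -/
theorem ladderDescent_ofArcsBottom : ((∀ (a j₀ j₁ L : ℕ), j₀ < j₁ → 2 * j₁ < L → ∀ (r : KZ.IntegralRep a), r.domain = {y | (∀ i, Real.tan (Real.pi * j₀ / L) < y i ∧ y i < Real.tan (Real.pi * j₁ / L)) ∧ (∀ i i' : Fin a, i < i' → y i < y i')} → Set.EqOn r.integrand (fun y => ∏ i, 2 / (1 + (y i) ^ 2)) r.domain → ∃ q : ℚ, ∀ (s : KZ.IntegralRep a), s.domain = {x | ∀ i, x i ∈ Set.Ioo (0:ℝ) 1} → Set.EqOn s.integrand (fun x => (q : ℝ) * ∏ i, 2 / (1 + (x i) ^ 2)) s.domain → KZ.Equivalent r s) ∧ (∀ (r : KZ.IntegralRep 1), r.domain = {z | 0 < z 0} → Set.EqOn r.integrand (fun z => 1 / (1 + (z 0) ^ 2)) r.domain → ∀ (s : KZ.IntegralRep 1), s.domain = {x | ∀ i, x i ∈ Set.Ioo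 (0:ℝ) 1} → Set.EqOn s.integrand (fun x => ∏ i, 2 / (1 + (x i) ^ 2)) s.domain → KZ.Equivalent r s)) → (∀ (k j L : ℕ), 0 < j → 2 * j < L → ∀ (r : KZ.IntegralRep (1 + (k + 1))), r.domain = {z | z (Fin.castAdd (k + 1) 0) ∈ Set.Ioo (0:ℝ) 1 ∧ (∀ i : Fin (k + 1), 0 < z (Fin.natAdd 1 i) ∧ z (Fin.natAdd 1 i) < Real.tan (Real.pi * j / L)) ∧ (∀ i i' : Fin (k + 1), i < i' → z (Fin.natAdd 1 i) < z (Fin.natAdd 1 i'))} → Set.EqOn r.integrand (fun z => (∏ i : Fin (k + 1), 2 / (1 + (z (Fin.natAdd 1 i)) ^ 2)) * (2 * z (Fin.natAdd 1 0) / ((1 - z (Fin.castAdd (k + 1) 0)) ^ 2 + (z (Fin.natAdd 1 0)) ^ 2 * (1 + z (Fin.castAdd (k + 1) 0)) ^ 2))) r.domain → ∃ q : ℚ, ∀ (s : KZ.IntegralRep (1 + (k + 1))), s.domain = {x | ∀ i, x i ∈ Set.Ioo (0:ℝ) 1} → Set.EqOn s.integrand (fun x => (q : ℝ) * ∏ i,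 2 / (1 + (x i) ^ 2)) s.domain → KZ.Equivalent r s) → (∀ (w j L : ℕ), 2 ≤ w → Even w → 0 < j → 2 * j < L → ∀ (r : KZ.IntegralRep w), r.domain = {x | ∀ i, x i ∈ Set.Ioo (0:ℝ) 1} → Set.EqOn r.integrand (fun x => ((1 - ∏ i, x i) - (Real.tan (Real.pi * j / L)) ^ 2 * (1 + ∏ i, x i)) / ((1 - ∏ i, x i) ^ 2 + (Real.tan (Real.pi * j / L)) ^ 2 * (1 + ∏ i, x i) ^ 2)) r.domain → ∃ q : ℚ, ∀ (s : KZ.IntegralRep w), s.domain = {x | ∀ i, x i ∈ Set.Ioo (0:ℝ) 1} → Set.EqOn s.integrand (fun x => (q : ℝ) * ∏ i, 2 / (1 + (x i) ^ 2)) s.domain → KZ.Equivalent r s) ∧ (∀ (w j L : ℕ), 3 ≤ w → Odd w → 0 < j → 2 * j < L → ∀ (r : KZ.IntegralRep w), r.domain = {x | ∀ i, x i ∈ Set.Ioo (0:ℝ) 1} → Set.EqOn r.integrand (fun x => 2 * Real.tan (Real.pi * j / L) / ((1 - ∏ i, x i) ^ 2 + (Real.tan (Real.pi * j / L)) ^ 2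 * (1 + ∏ i, x i) ^ 2)) r.domain → ∃ q : ℚ, ∀ (s : KZ.IntegralRep w), s.domain = {x | ∀ i, x i ∈ Set.Ioo (0:ℝ) 1} → Set.EqOn s.integrand (fun x => (q : ℝ) * ∏ i, 2 / (1 + (x i) ^ 2)) s.domain → KZ.Equivalent r s) ∧ (∀ (w : ℕ), 2 ≤ w → Even w → ∀ (r : KZ.IntegralRep w), r.domain = {x | ∀ i, x i ∈ Set.Ioo (0:ℝ) 1} → Set.EqOn r.integrand (fun x => 1 / (1 - ∏ i, x i)) r.domain → ∃ q : ℚ, ∀ (s : KZ.IntegralRep w), s.domain = {x | ∀ i, x i ∈ Set.Ioo (0:ℝ) 1} → Set.EqOn s.integrand (fun x => (q : ℝ) * ∏ i, 2 / (1 + (x i) ^ 2)) s.domain → KZ.Equivalent r s) ∧ (∀ (w : ℕ), 2 ≤ w → Even w → ∀ (r : KZ.IntegralRep w), r.domain = {x | ∀ i, x i ∈ Set.Ioo (0:ℝ) 1} → Set.EqOn r.integrand (fun x => 1 / (1 + ∏ i, x i)) r.domain → ∃ q : ℚ, ∀ (s : KZ.IntegralRep w), s.domain = {x | ∀ i, x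 i ∈ Set.Ioo (0:ℝ) 1} → Set.EqOn s.integrand (fun x => (q : ℝ) * ∏ i, 2 / (1 + (x i) ^ 2)) s.domain → KZ.Equivalent r s) :=
  fun hA hB => stub_ladderDescent stub_ladderEngine hA hB

end Summit.KontsevichZagierPeriods.Theorems.HurwitzMicroSectorsHurwitzSectorComplement

end
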